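import Summits.BirchSwinnertonDyer.Rank1Residual.ManinAdditive.GammaOneHalfHomothety
import Summits.BirchSwinnertonDyer.Rank1Residual.ManinAdditive.CuspidalKummerUFamily
import HarnessLib

/-!
# The `ℚ(i)`-cusp pincer at `16 ∥ N` (cell `bsd-f2-manin`, es g33, MEMO-es §54; FILE A⁹ — land-ready copy of Sketch-es-g33.lean)

THE `ℚ(i)`-CUSP PINCER AT `16 ∥ N`: for an `X₀(N)`-optimal `u`-family model `W₀ : y² = (x+u)(x²+4)` (up to translation),
`N = 16·M`, `M` odd squarefree, the image `ψ(C₀) ⊂ W₀` of the FULL cuspidal group (all twelve cusps of `X₀(16p)`, the four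
non-rational ones defined over `ℚ(i)`) has 2-primary part inside `⟨T⟩ ≅ ℤ/2`, `T` the (real, blind) rational 2-torsion point.
Paper proof (MEMO-es §54.2): (i) `f(τ+½) = −f(τ)` at `4 ∣ N` gives `{∞, r+½}_f = −{∞,r}_f`; (ii) `{∞,−r}_f = conj {∞,r}_f`;
(iii) at `16 ∥ N`, `M` odd squarefree, every non-rational cusp `r = a/(4d)` satisfies `r̄ ∼ −r ∼ r + ½`, so `σψ(r) = −ψ(r)`,
i.e. `ψ(r) ∈ W₀(ℚ(i))^{σ=−1} = θ(W₀^{(−1)}(ℚ))_tors`, and `W₀^{(−1)}` is the `u`-family model `−u` whose rational torsion has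
2-part `⟨T⟩` (`u ≠ 0`: `u²+4` is not a square); rational cusps map into `W₀(ℚ)_tors`, 2-part `⟨T⟩`.  Typed f-intrinsically
(`Λ_{W₀} = c₀·Λ_f`, so `ψ(r) ↔ {∞,r}_f mod Λ_f`).  E-es-161 is a THEOREM-candidate; E-es-162 (`ψ(C₀) ≠ 0`) is the open bit
(LAW; census 31/31; the `16p` twin of an's E-an-150); the glue to the tree's `CuspidalIndexTwo` / E-es-123 / F-es-21♭K chain is
kernel-checked below.  Nothing is asserted.

TYPER NOTE (typer g21, T-es-59).  SOURCE = HOME/es/g33/QiCuspPincer-es-g33.lean (FILE A⁹) sha16 7e548d06cafde179 (261 l.; es: farm rc 0·0·0·0;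
BC7 CLEAN vs `ManinOddAtFour` and vs 6♭‴, Probe-es-g33.lean / .out.txt / .verdicts.txt in HOME/es/g33/) VERBATIM except this note (es's own
`@[conjecture]` tags; bodies, names, namespace `…ManinAdditive.QiCuspPincer`, imports untouched).  ROUTE-INDEPENDENT: imports the landed
`…ManinAdditive.GammaOneHalfHomothety` (T-es-39, p705510; transitively Theses-free — 60 Summits modules walked, 0 `Theses` edges) +
`…ManinAdditive.CuspidalKummerUFamily` + HarnessLib.  CONTENT (es MEMO-es §54 = HOME/es/g33/MEMO-es-sec54.md): f-intrinsic predicates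
`CuspidalTwoImageRealCyclic` / `CuspidalImageTwoPrimary` / `CuspidalImageNonzero` on ψ(C₀) = 𝓛̄_f/Λ_f; `@[conjecture]` rows **E-es-161
`UFamilyCuspidalTwoImageAtSixteen`** (the ℚ(i)-cusp pincer at 16 ∥ N, N/16 squarefree: ψ(C₀)[2^∞] ⊆ ⟨T⟩ with T real — es: THEOREM-candidate,
paper proof MEMO-es §54.2) and **E-es-162 `UFamilyCuspidalImageNonzeroAtSixteen`** (ψ(C₀) ≠ 0 — the open bit; the 16p twin of an's E-an-150);
PROVED (es, kernel-checked here): descent lemmas `mem_of_odd_mul_mem`, `mem_or_sub_mem_of_odd_of_twoPow`, `mem_or_sub_mem_of_mem_symbolClosure`,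
**S-es-g33-1 `cuspidalIndexTwo_of_realCyclic`** (pincer ∧ 2-primary ∧ nonzero ⟹ the tree's `CuspidalIndexTwo`), `uFamily_hasRationalTwoTorsion`,
`uFamily_allRationalTwoTorsionBlind`, `gammaOneOdd_on_uFamily_sixteen` (2 ∤ c₁ on the wild u-family ⟸ F-es-21♭K `kato_isIntegral_twistedSymbolSum_two_symbolClosure`
∧ E-es-123 `HalfHomothetyOnTotallyBlind` ∧ E-es-161 ∧ E-es-162 ∧ 2-primary, via the tree theorem `gammaOneOdd_on_cuspidalIndexTwo_blindClasses`),
`katoFactTwoAt_on_uFamily_sixteen`, the closed Prop `KatoNeronIntegralTwoGamma1OptimalOnUFamilySixteen` (6♭‴ restricted to the wild u-family locus —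
es's recut OFFER to the C2 LEAD, L-es-g33-1) + its assembly `…_of`.  NOT IN PRINT as typed (cell laws; Kato's reciprocity enters by name).  BC5 (es):
PSIC0-BLIND89-v1.tsv 17921446364c1a61 — E-es-161 31/31 classes N = 16(u²+4) ≤ 481 652 (+ 55/55 at 4(u²+4), 2/2 at 128; correctly EXCLUDES 32a1,
32 ∣ N), E-es-162 31/31 (ψ(0)₂ = T 31/31); 0 violations.  CHEAPEST FALSIFIER: a flat u-family member (𝓛̄_f = Λ_f) at 16 ∥ N beyond the table.  REFUTER:
ref1 (next gen) PENDING at landing; ref2 PENDING.  es asked for `--supports stmt-BirchSwinnertonDyer-22967`; refused by the gate for `…/ManinAdditive/`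
targets (gotcha 108) — bears_on carried here: stmt-BirchSwinnertonDyer-22967 (C2 `ManinOddAtFour`; 6♭‴ `KatoNeronIntegralTwoGamma1OptimalOnBlindCore`
is needed AS STATED only at 32 ∣ N per es).  Typer checks: 15 decl names fresh tree-wide; no `[cite:]` keys; no instances, no notation; 261 + note <
400 lines.  PARTITION 0 · beyond-print theorem: no · BSD is not proved by this; Manin `c = 1` is not proved by this; C2 OPEN.
-/

noncomputable section

open scoped Classical MatrixGroups ModularForm ComplexConjugate
open CongruenceSubgroup Complex WeierstrassCurve Literature.NumberTheory.EllipticCurves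
open Literature.NumberTheory.EllipticCurves.ModularForms
open Summit.BirchSwinnertonDyer.Rank1Residual.ManinAdditive
open Summit.BirchSwinnertonDyer.Rank1Residual.ManinAdditive.KatoCurve
open Summit.BirchSwinnertonDyer.BirchSwinnertonDyer.Theorems.ManinLocalTwoThree
open Summit.BirchSwinnertonDyer.BirchSwinnertonDyer.Theorems.ManinLocalTwoThree.GammaOneKatoRoad

namespace Summit.BirchSwinnertonDyer.Rank1Residual.ManinAdditive.QiCuspPincer

variable {N : ℕ}

/-! ## §A f-intrinsic predicates on the cuspidal image `ψ(C₀) = 𝓛̄_f / Λ_f` -/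

/-- `ψ(C₀)[2^∞]` lies in ONE real cyclic group of order `≤ 2`: there is a half-period `t` (`2t ∈ Λ_f`) which is REAL
(`t − t̄ ∈ Λ_f`) such that every modular symbol, multiplied by a suitable ODD integer, is `≡ 0` or `≡ t (mod Λ_f)`. -/
def CuspidalTwoImageRealCyclic (f : CuspForm (Gamma0 N) 2) : Prop :=
  ∃ t : ℂ, 2 * t ∈ periodLattice f ∧ t - conj t ∈ periodLattice f ∧
    ∀ r : ℚ, ∃ k : ℕ, Odd k ∧
      ((k : ℂ) * modularSymbol f r ∈ periodLattice f ∨ (k : ℂ) * modularSymbol f r - t ∈ periodLattice f)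

/-- `ψ(C₀)` is a 2-group: every modular symbol is killed by a power of `2` modulo `Λ_f`
(on the `u`-family: `|u| ≠ 1`; fails exactly at 20a1/80b1 where `ψ(C₀) ≅ ℤ/6`). -/
def CuspidalImageTwoPrimary (f : CuspForm (Gamma0 N) 2) : Prop :=
  ∀ r : ℚ, ∃ j : ℕ, (2 : ℂ) ^ j * modularSymbol f r ∈ periodLattice f

/-- `ψ(C₀) ≠ 0`: some cusp of `X₀(N)` does not map to the origin of the optimal curve (NONFLAT). -/
def CuspidalImageNonzero (f : CuspForm (Gamma0 N) 2) : Prop :=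
  ∃ r : ℚ, modularSymbol f r ∉ periodLattice f

/-! ## §B The two candidates (cell rows E-es-161, E-es-162; nothing asserted) -/

/-- **E-es-161 `UFamilyCuspidalTwoImageAtSixteen`** (THEOREM-candidate, the `ℚ(i)`-cusp pincer; MEMO-es §54.2):
for an `X₀(N)`-optimal `u`-family model with `16 ∥ N`, `N/16` squarefree, `ψ(C₀)[2^∞] ⊆ ⟨T⟩` with `T` real.
BC5: PSIC0-BLIND89-v1.tsv 17921446364c1a61 — 31/31 classes `N = 16(u²+4) ≤ 481 652` (and 55/55 at `4(u²+4)`, 2/2 at 128);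
the one in-range class it must and does exclude is 32a1 (`ψ(1/8) = T′` non-real, `ψ(C₀) ≅ ℤ/2 × ℤ/4`; `32 ∣ N`). -/
@[conjecture]
def UFamilyCuspidalTwoImageAtSixteen : Prop :=
  ∀ (W : WeierstrassCurve ℚ) [W.IsElliptic] [W.IsGloballyMinimal] {N : ℕ} [NeZero N]
    (D : ModularParametrizationData W N),
    (∀ z ∈ D.L.lattice, ∃ w ∈ periodLattice D.f, z = D.c * w) →
    2 ^ 4 ∣ N → ¬ 2 ^ 5 ∣ N → Squarefree (N / 2 ^ 4) → CuspidalKummer.IsUFamilyModel W →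
    CuspidalTwoImageRealCyclic D.f

/-- **E-es-162 `UFamilyCuspidalImageNonzeroAtSixteen`** (LAW = the open bit; MEMO-es §54.4): for an `X₀(N)`-optimal
`u`-family model with `16 ∥ N`, SOME cusp maps to a non-zero point (`ψ(C₀) ≠ 0`; observed: `ψ(0) = T` always).
BC5: 31/31 (`ψ(0)₂ = T` 31/31, `ψ(¼)₂ = T` 31/31); the `4(u²+4)` twin of this bit is an's E-an-150 (odd modular degree)
via THEOREM C `FourPCuspZeroParity` + the hexagon E-an-83.  Why it might fail: a FLAT family member beyond the tables
(`𝓛̄_f = Λ_f`, even «cusp-zero» valuation), which would also break E-an-150 at its `χ₋₄`-twin if an's twist parity transfer holds. -/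
@[conjecture]
def UFamilyCuspidalImageNonzeroAtSixteen : Prop :=
  ∀ (W : WeierstrassCurve ℚ) [W.IsElliptic] [W.IsGloballyMinimal] {N : ℕ} [NeZero N]
    (D : ModularParametrizationData W N),
    (∀ z ∈ D.L.lattice, ∃ w ∈ periodLattice D.f, z = D.c * w) →
    2 ^ 4 ∣ N → ¬ 2 ^ 5 ∣ N → CuspidalKummer.IsUFamilyModel W →
    CuspidalImageNonzero D.f

/-! ## §C Kernel glue: pincer ∧ 2-primary ∧ nonzero ⟹ the tree's `CuspidalIndexTwo` -/

/-- Odd-multiple descent: `k` odd, `k·x ∈ Λ`, `2x ∈ Λ` ⟹ `x ∈ Λ` (`x = k·x − ((k−1)/2)·2x`). -/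
theorem mem_of_odd_mul_mem {Λ : AddSubgroup ℂ} {x : ℂ} {k : ℕ} (hk : Odd k) (hkx : (k : ℂ) * x ∈ Λ)
    (h2x : 2 * x ∈ Λ) : x ∈ Λ := by
  obtain ⟨m, rfl⟩ := hk
  have hm := Λ.nsmul_mem h2x m
  rw [nsmul_eq_mul] at hm
  have key : x = ((2 * m + 1 : ℕ) : ℂ) * x - (m : ℂ) * (2 * x) := by push_cast; ring
  rw [key]
  exact Λ.sub_mem hkx hm

/-- 2-power descent: from `2t ∈ Λ`, `k` odd with `k·s ≡ 0` or `≡ t (mod Λ)`, and `2^j·s ∈ Λ`, conclude `s ≡ 0` or `s ≡ t`. -/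
theorem mem_or_sub_mem_of_odd_of_twoPow {Λ : AddSubgroup ℂ} {t s : ℂ} (h2t : 2 * t ∈ Λ)
    {k : ℕ} (hk : Odd k) (hks : (k : ℂ) * s ∈ Λ ∨ (k : ℂ) * s - t ∈ Λ) :
    ∀ j : ℕ, (2 : ℂ) ^ j * s ∈ Λ → (s ∈ Λ ∨ s - t ∈ Λ) := by
  intro j
  induction j with
  | zero => intro h; left; simpa using h
  | succ j ih =>
    intro hj
    have h2x : 2 * ((2 : ℂ) ^ j * s) ∈ Λ := by convert hj using 1; ring
    rcases hks with hA | hB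
    · have hkx : (k : ℂ) * ((2 : ℂ) ^ j * s) ∈ Λ := by
        have h := Λ.nsmul_mem hA (2 ^ j)
        rw [nsmul_eq_mul] at h
        convert h using 1; push_cast; ring
      exact ih (mem_of_odd_mul_mem hk hkx h2x)
    · rcases Nat.eq_zero_or_pos j with rfl | hjpos
      · right
        obtain ⟨m, rfl⟩ := hk
        have h2s : 2 * s ∈ Λ := by simpa using h2x
        have hm := Λ.nsmul_mem h2s m
        rw [nsmul_eq_mul] at hm
        have key : s - t = (((2 * m + 1 : ℕ) : ℂ) * s - t) - (m : ℂ) * (2 * s) := by push_cast; ring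
        rw [key]
        exact Λ.sub_mem hB hm
      · have h2jt : (2 : ℂ) ^ j * t ∈ Λ := by
          obtain ⟨i, rfl⟩ := Nat.exists_eq_succ_of_ne_zero (Nat.pos_iff_ne_zero.mp hjpos)
          have h := Λ.nsmul_mem h2t (2 ^ i)
          rw [nsmul_eq_mul] at h
          convert h using 1; push_cast; rw [Nat.succ_eq_add_one, pow_succ]; ring
        have hkx : (k : ℂ) * ((2 : ℂ) ^ j * s) ∈ Λ := by
          have h := Λ.nsmul_mem hB (2 ^ j)
          rw [nsmul_eq_mul] at h
          have h' := Λ.add_mem h h2jt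
          convert h' using 1; push_cast; ring
        exact ih (mem_of_odd_mul_mem hk hkx h2x)

/-- Closure step: if every modular symbol is `≡ 0` or `≡ t (mod Λ_f)` with `2t ∈ Λ_f`, so is every element of `𝓛̄_f`. -/
theorem mem_or_sub_mem_of_mem_symbolClosure {f : CuspForm (Gamma0 N) 2} {t : ℂ}
    (h2t : 2 * t ∈ periodLattice f)
    (hgen : ∀ r : ℚ, modularSymbol f r ∈ periodLattice f ∨ modularSymbol f r - t ∈ periodLattice f)
    {z : ℂ} (hz : z ∈ symbolClosure f) : z ∈ periodLattice f ∨ z - t ∈ periodLattice f := by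
  induction hz using AddSubgroup.closure_induction with
  | mem x hx =>
    obtain ⟨r, rfl⟩ := hx
    exact hgen r
  | zero => exact Or.inl (periodLattice f).zero_mem
  | add x y _ _ ihx ihy =>
    rcases ihx with hx | hx <;> rcases ihy with hy | hy
    · exact Or.inl ((periodLattice f).add_mem hx hy)
    · exact Or.inr (by convert (periodLattice f).add_mem hx hy using 1; ring)
    · exact Or.inr (by convert (periodLattice f).add_mem hx hy using 1; ring)
    · exact Or.inl (by convert (periodLattice f).add_mem ((periodLattice f).add_mem hx hy) h2t using 1; ring)
  | neg x _ ihx =>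
    rcases ihx with hx | hx
    · exact Or.inl ((periodLattice f).neg_mem hx)
    · exact Or.inr (by convert (periodLattice f).sub_mem ((periodLattice f).neg_mem hx) h2t using 1; ring)

/-- **S-es-g33-1 (PROVED): pincer ∧ 2-primary ∧ nonzero ⟹ `CuspidalIndexTwo f`** (`|ψ(C₀)| = 2`, the hypothesis of the
tree's LAW E-es-123 `HalfHomothetyOnTotallyBlind`). -/
theorem cuspidalIndexTwo_of_realCyclic (f : CuspForm (Gamma0 N) 2) (h₁ : CuspidalTwoImageRealCyclic f)
    (h₂ : CuspidalImageTwoPrimary f) (h₃ : CuspidalImageNonzero f) : CuspidalIndexTwo f := by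
  obtain ⟨t, h2t, -, hk⟩ := h₁
  have hgen : ∀ r : ℚ, modularSymbol f r ∈ periodLattice f ∨ modularSymbol f r - t ∈ periodLattice f :=
    fun r => by
      obtain ⟨k, hko, hks⟩ := hk r
      obtain ⟨j, hj⟩ := h₂ r
      exact mem_or_sub_mem_of_odd_of_twoPow h2t hko hks j hj
  obtain ⟨r₀, hr₀⟩ := h₃
  refine ⟨⟨modularSymbol f r₀, AddSubgroup.subset_closure ⟨r₀, rfl⟩, hr₀⟩, fun w hw w' hw' => ?_⟩
  rcases mem_or_sub_mem_of_mem_symbolClosure h2t hgen hw with h | h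
  · exact Or.inl h
  rcases mem_or_sub_mem_of_mem_symbolClosure h2t hgen hw' with h' | h'
  · exact Or.inr (Or.inl h')
  · exact Or.inr (Or.inr (by convert (periodLattice f).sub_mem h h' using 1; ring))

/-! ## §D The `u`-family model facts the tree's E-es-123 consumer wants (PROVED) -/

/-- A `u`-family model has the rational 2-torsion point `e = −(s+u)`. -/
theorem uFamily_hasRationalTwoTorsion {W : WeierstrassCurve ℚ} (h : CuspidalKummer.IsUFamilyModel W) :
    ShimuraLedger.HasRationalTwoTorsion W := by
  obtain ⟨u, s, -, -, h₂, h₄, h₆⟩ := h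
  refine ⟨((-(s + u) : ℤ) : ℚ), ?_⟩
  rw [h₂, h₄, h₆]; push_cast; ring

/-- On a `u`-family model EVERY rational 2-torsion point is Kummer-blind (the cubic is `(x+s+u)((x+s)²+4)`, so
`−(s+u)` is the only rational root; its blindness is `kummerBlindAtTwo_of_uFamily`). -/
theorem uFamily_allRationalTwoTorsionBlind {W : WeierstrassCurve ℚ} (h : CuspidalKummer.IsUFamilyModel W) :
    ShimuraLedger.AllRationalTwoTorsionBlind W := by
  obtain ⟨u, s, -, -, h₂, h₄, h₆⟩ := h
  intro e he
  rw [h₂, h₄, h₆] at he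
  have hfac : (e + ((s + u : ℤ) : ℚ)) * ((e + (s : ℚ)) ^ 2 + 4) = 0 := by
    have : (e + ((s + u : ℤ) : ℚ)) * ((e + (s : ℚ)) ^ 2 + 4) =
        e ^ 3 + ((3 * s + u : ℤ) : ℚ) * e ^ 2 + ((3 * s ^ 2 + 2 * s * u + 4 : ℤ) : ℚ) * e +
          (((s + u) * (s ^ 2 + 4) : ℤ) : ℚ) := by push_cast; ring
    rw [this]; exact he
  have hpos : (e + (s : ℚ)) ^ 2 + 4 ≠ 0 := by positivity
  have he' : e = ((-(s + u) : ℤ) : ℚ) := by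
    have := (mul_eq_zero.mp hfac).resolve_right hpos
    push_cast at this ⊢; linarith
  exact ⟨3 * s + u, 3 * s ^ 2 + 2 * s * u + 4, -(s + u), h₂.symm, h₄.symm, he'.symm,
    CuspidalKummer.kummerBlindAtTwo_of_uFamily u s⟩

/-! ## §E C2¹ and the 6♭‴ conclusion on the `16 ∥ N` `u`-family ⟸ F-es-21♭K ∧ E-es-123 ∧ E-es-161 ∧ E-es-162 ∧ 2-primary (KERNEL) -/

/-- **`2 ∤ c₁` on the wild `u`-family** (`16 ∥ N`, `N/16` squarefree, `ψ(C₀)` a 2-group): from Kato's printed reciprocity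
F-es-21♭K, the cell's laws E-es-123 / E-es-162, the pincer E-es-161, by the tree theorem
`gammaOneOdd_on_cuspidalIndexTwo_blindClasses`. -/
theorem gammaOneOdd_on_uFamily_sixteen
    (hK : kato_isIntegral_twistedSymbolSum_two_symbolClosure) (h123 : HalfHomothetyOnTotallyBlind)
    (h161 : UFamilyCuspidalTwoImageAtSixteen) (h162 : UFamilyCuspidalImageNonzeroAtSixteen)
    (W₁ W₀ : WeierstrassCurve ℚ) [W₁.IsElliptic] [W₁.IsGloballyMinimal] [W₀.IsElliptic] [W₀.IsGloballyMinimal]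
    [NeZero N] (D₁ : Gamma1ParametrizationData W₁ N) (D₀ : ModularParametrizationData W₀ N)
    (hiso : IsIsogenous W₁ W₀) (hopt : D₁.IsOptimal)
    (hopt₀ : ∀ z ∈ D₀.L.lattice, ∃ w ∈ periodLattice D₀.f, z = D₀.c * w)
    (h16 : 2 ^ 4 ∣ N) (h32 : ¬ 2 ^ 5 ∣ N) (hsq : Squarefree (N / 2 ^ 4))
    (hU : CuspidalKummer.IsUFamilyModel W₀) (h2p : CuspidalImageTwoPrimary D₀.f) :
    ¬ (2 : ℤ) ∣ D₁.maninConstant := by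
  have h4 : 2 ^ 2 ∣ N := dvd_trans (pow_dvd_pow 2 (by norm_num)) h16
  obtain ⟨u, s, ha₁, ha₃, -, -, -⟩ := id hU
  exact gammaOneOdd_on_cuspidalIndexTwo_blindClasses hK h123 W₁ W₀ D₁ D₀ hiso hopt hopt₀ h4 ha₁ ha₃
    (uFamily_hasRationalTwoTorsion hU) (uFamily_allRationalTwoTorsionBlind hU)
    (cuspidalIndexTwo_of_realCyclic D₀.f (h161 W₀ D₀ hopt₀ h16 h32 hsq hU) h2p (h162 W₀ D₀ hopt₀ h16 h32 hU))

/-- **Stub 6♭‴'s CONCLUSION `KatoFactTwoAt` on the wild `u`-family, outright** (no period-domination escape needed):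
same hypotheses; through `HalfHomothety` (E-es-123) and `katoFactTwoAt_of_twoPowerHomothety` (F-es-21♭K by name). -/
theorem katoFactTwoAt_on_uFamily_sixteen
    (hK : kato_isIntegral_twistedSymbolSum_two_symbolClosure) (h123 : HalfHomothetyOnTotallyBlind)
    (h161 : UFamilyCuspidalTwoImageAtSixteen) (h162 : UFamilyCuspidalImageNonzeroAtSixteen)
    (V W₀ : WeierstrassCurve ℚ) [V.IsElliptic] [V.IsGloballyMinimal] [W₀.IsElliptic] [W₀.IsGloballyMinimal]
    [NeZero N] (D₁ : Gamma1ParametrizationData V N) (D₀ : ModularParametrizationData W₀ N)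
    (hiso : IsIsogenous V W₀) (hopt : D₁.IsOptimal)
    (hopt₀ : ∀ z ∈ D₀.L.lattice, ∃ w ∈ periodLattice D₀.f, z = D₀.c * w)
    (h16 : 2 ^ 4 ∣ N) (h32 : ¬ 2 ^ 5 ∣ N) (hsq : Squarefree (N / 2 ^ 4))
    (hU : CuspidalKummer.IsUFamilyModel W₀) (h2p : CuspidalImageTwoPrimary D₀.f) :
    KatoFactTwoAt V D₁.f := by
  have h4 : 2 ^ 2 ∣ N := dvd_trans (pow_dvd_pow 2 (by norm_num)) h16
  have hf : D₁.f = D₀.f := D₁.isNewformOf.unique (D₀.isNewformOf.of_isIsogenous hiso)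
  obtain ⟨u, s, ha₁, ha₃, -, -, -⟩ := id hU
  have hC : CuspidalIndexTwo D₀.f :=
    cuspidalIndexTwo_of_realCyclic D₀.f (h161 W₀ D₀ hopt₀ h16 h32 hsq hU) h2p (h162 W₀ D₀ hopt₀ h16 h32 hU)
  have hh : HalfHomothety D₁.f := by
    rw [hf]
    exact h123 W₀ D₀ hopt₀ h4 ha₁ ha₃ (uFamily_hasRationalTwoTorsion hU) (uFamily_allRationalTwoTorsionBlind hU) hC
  exact katoFactTwoAt_of_twoPowerHomothety hK V D₁ hopt (twoPowerHomothety_of_half hh)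

/-- **6♭‴ RESTRICTED to the wild `u`-family locus, as a closed `Prop`** (the recut offered to the LEAD, L-es-g33-1):
`KatoFactTwoAt` for every `X₁(N)`-optimal `V` (`16 ∥ N`, `N/16` squarefree) whose class contains a lattice-optimal `u`-family
model with 2-primary cuspidal image. -/
def KatoNeronIntegralTwoGamma1OptimalOnUFamilySixteen : Prop :=
  ∀ (V : WeierstrassCurve ℚ) [V.IsElliptic] [V.IsGloballyMinimal] {N : ℕ} [NeZero N]
    (D₁ : Gamma1ParametrizationData V N), D₁.IsOptimal → 2 ^ 4 ∣ N → ¬ 2 ^ 5 ∣ N → Squarefree (N / 2 ^ 4) →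
    (∃ (W₀ : WeierstrassCurve ℚ) (_ : W₀.IsElliptic) (_ : W₀.IsGloballyMinimal) (D₀ : ModularParametrizationData W₀ N),
      IsIsogenous V W₀ ∧ (∀ z ∈ D₀.L.lattice, ∃ w ∈ periodLattice D₀.f, z = D₀.c * w) ∧
      CuspidalKummer.IsUFamilyModel W₀ ∧ CuspidalImageTwoPrimary D₀.f) →
    KatoFactTwoAt V D₁.f

/-- F-es-21♭K ∧ E-es-123 ∧ E-es-161 ∧ E-es-162 ⟹ the restricted 6♭‴ (kernel-checked assembly). -/
theorem katoNeronIntegralTwoGamma1OptimalOnUFamilySixteen_of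
    (hK : kato_isIntegral_twistedSymbolSum_two_symbolClosure) (h123 : HalfHomothetyOnTotallyBlind)
    (h161 : UFamilyCuspidalTwoImageAtSixteen) (h162 : UFamilyCuspidalImageNonzeroAtSixteen) :
    KatoNeronIntegralTwoGamma1OptimalOnUFamilySixteen := by
  intro V _ _ N _ D₁ hopt h16 h32 hsq hex
  obtain ⟨W₀, hE, hM, D₀, hiso, hopt₀, hU, h2p⟩ := hex
  haveI := hE; haveI := hM
  exact katoFactTwoAt_on_uFamily_sixteen hK h123 h161 h162 V W₀ D₁ D₀ hiso hopt hopt₀ h16 h32 hsq hU h2p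

end Summit.BirchSwinnertonDyer.Rank1Residual.ManinAdditive.QiCuspPincer

end
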